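import Literature.MathematicalPhysics.QuantumFieldTheory.Balaban1983to89.Node00.WilsonActionSecondVariationGauge
import Literature.MathematicalPhysics.QuantumFieldTheory.Balaban1983to89.Node00.WilsonActionSecondVariationL2Letters
import Literature.MathematicalPhysics.QuantumFieldTheory.Balaban1983to89.T4AxialGaugeSmallField
import Literature.MathematicalPhysics.QuantumFieldTheory.Balaban1983to89.BlockAveragingFederbush
import HarnessLib

/-!
# The ON-EVENT Hessian bound of the Wilson action in the axial gauge — the knit (A) of the crux idea «gross-sd-transfer» (LINE 28 candidate on `UnitScaleTilt.HistoryTailL`,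
# stmt-QuantumFields-19936; ideator ym-r3-idea-2 g15 2026-08-29T17:10:36Z: «the residual non-abelian crux of LINE 28 is precisely (A) the ON-EVENT Hessian bound
# `K_G(u) := sup_{U ∈ G} |∂_u∂_u A_W(U)| ≤ (1+ε)·‖du‖₂² + (lower order)`, ε ≲ C·p·√γ·L^{(4j−K)∕2}»)

T. Bałaban, *Propagators for lattice gauge theories in a background field*, Commun. Math. Phys. **99** (1985) 389–434 [Balaban1985BackgroundPropagators], (3.6)–(3.7) p. 391 and
(3.10) p. 392 (the second variation `⟨A, Δ^η(U)A⟩ = ⟨A, D*DA⟩ + ⟨A, Δ′A⟩` of the Wilson action at a background, `Δ′` carrying `Re U(∂p) − 1` and `Im U(∂p)`); T. Bałaban, *Large field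
renormalization. II*, Commun. Math. Phys. **122** (1989) 355–392 [Balaban1989LargeFieldII], p. 357–358: *«doing a proper gauge transformation … The leading term in the expansion is the
quadratic form with the background field identically equal to 1 … The above inequality holds for U₀ in an arbitrary gauge»*; [Balaban1984PropagatorsI] CMP **95** (1.10)–(1.11) p. 19 (axial gauge).

EVERYTHING BELOW IS A KNIT OF LANDED THEOREMS (this seat's LOCATE #4, 19936 evidence #56): the second variation of the Setup action `wilsonAction4` along the ray
`s ↦ Node00.expChart U (s • X)` is GAUGE COVARIANT and within `4·Σ_p δ_p·s_p(X)²` of its value at the PURE GAUGE `1^{u⁻¹}` whenever the transformed background `U^u` has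
its bond variables within `δ_p` of `1` on `∂p` (✓ `Node00.abs_deriv_deriv_wilsonAction4_expChart_sub_pureGauge_le`), that value being the FLAT form of the `Ad_u`-rotated letters
(✓ `Node00.deriv_deriv_wilsonAction4_expChart_pureGauge_eq_norm_sq`); the AXIAL GAUGE of a non-wrapping box makes the bond variables `(d−1)·n·θ`-close to `1` when the box
plaquettes are `θ`-small (✓ `T4AxialGaugeSmallField.dist1_gaugeAct_axialGauge_le_of_mem_boxBonds`, w8-19936 g9's LOCATE #2); `Σ_p s_p² ≤ 8(d−1)Σ_b ‖·‖²`
(✓ `Node00.sum_plaq_boundary_sq_le`).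

WHAT THIS FILE PROVES (kernel; 0 `def`, 0 `sorry`; `GaugeField P j (SU N)`, ANY `Params`, ANY level `j`; `u_U := axialGauge U lo hi`; the test direction is chosen IN THE AXIAL PICTURE,
`X_b := Ad_{(u_U(b₊))⁻¹} Y_b` — so it is `U`-DEPENDENT, the price annex 1 §2 (ii′) of the card already books):
* ★★★ `abs_hessian_axialRotated_sub_flat_le`: if `PlaqSmallOn (boxPlaqs lo hi) θ U` (box side `≤ n < sitesPerDir j`) and `Y` vanishes on the boundary of every plaquette that is
  not fully inside the box, then `|d²∕ds² A_W(expChart U (s • X))∣₀ − (1∕N)·Σ_p ‖Y₁ + Y₂ − Y₃ − Y₄‖²| ≤ 4(d−1)·n·θ · Σ_p s_p(Y)²` — the on-event Hessian IS the flat `∂*∂` form of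
  `Y` up to `O(nθ)·Σ s_p²`;
* ★★★ `abs_hessian_axialGaugeRep_sub_flat_le` ∕ `hessian_axialGaugeRep_le_flat_add_l2` (§3): THE SAME ON THE AXIAL-GAUGE REPRESENTATIVE `V = U^{u_U}` with a FIXED direction `Y`
  (annex 4 §0 construction C3 ∕ §6 `stub_hessOnEvent` shape — the `U`-dependence moved into `V(U)`); equivalent to §2 by gauge covariance (✓ `deriv_deriv_wilsonAction4_expChart_gaugeAct`);
* §4 the support margin: `Y = 0` off `boxBonds (lo+1) (hi−1)` ⇒ the hypothesis `hY` (torus-box bookkeeping), and ★★★ `hessian_axialGaugeRep_le_flat_add_l2_of_vanish_off_inner`;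
* §5 ★★★ `abs_hessian_sub_flat_le_of_bondSmallOn_box` ∕ `hessian_le_flat_add_l2_of_bondSmallOn_box`: annex 4 §6's BONDWISE hypothesis shape («`max_{b∈Λ}dist₁(V_b,1) ≤ η`»), any `V`;
* ★★★ `hessian_axialRotated_le_flat_add` (the one-sided reading (A)) and ★★ `…_l2`: `… ≤ (1∕N)·Σ_p‖(dY)_p‖² + 32(d−1)²·n·θ·Σ_b‖Y_b‖²` — with a Poincaré constant `Σ_b‖Y_b‖² ≤ C_P‖dY‖²`
  for the chosen test field (✓ (D3♭) `exists_box_leastSquares_potential`, w5) this is «`K_G ≤ (1 + ε)‖dY‖²`», `ε = 32(d−1)²·n·θ·C_P·N` — polynomial in `n = 17L^{j}` times `θ(K)`,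
  the window family of annex 1 (i).
HONEST SCOPE.  Deterministic statements about ONE configuration on the θ-small box event; the test field's `U`-dependence (defect (ii′)), the Poincaré constant, the cut-off
leakage (B), S_lin (C) and the probabilistic assembly are NOT here; nothing of S_dom ∕ «ShallowFluxSecondMomentL» ∕ (Q) ∕ K1 ∕ `HistoryTailL` is proved; rung R3 (YM₃ on T³) is NOT
d = 4, NOT infinite volume, NOT a mass gap, NOT Clay; the Yang–Mills mass gap is NOT proved.  Width seat ym3-torus-px10 g7; `--supports stmt-QuantumFields-19936 --as helper`.
-/

set_option autoImplicit false

noncomputable section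

open scoped BigOperators Matrix.Norms.L2Operator

namespace Summit.QuantumFields.YangMills.Theorems.UnitScaleGibbsOnEventHessianAxialGauge

open Literature.MathematicalPhysics.QuantumFieldTheory.Balaban1983to89
open Literature.MathematicalPhysics.QuantumFieldTheory.Balaban1983to89.T4AdjointCovarianceUnitary
  (lieSU specialUnitaryAd specialUnitaryAd_inv_apply norm_specialUnitaryAd coe_specialUnitaryAd)
open Literature.MathematicalPhysics.QuantumFieldTheory.Balaban1983to89.T4AxialGaugeSmallField
  (boxPlaqs boxBonds axialGauge castSite castSite_add_e dist1_gaugeAct_axialGauge_le_of_mem_boxBonds)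
open Literature.MathematicalPhysics.QuantumFieldTheory.Balaban1983to89.B7Prop1Explicit (e e_apply)
open Literature.MathematicalPhysics.QuantumFieldTheory.Balaban1983to89.Node00
  (expChart abs_deriv_deriv_wilsonAction4_expChart_sub_pureGauge_le deriv_deriv_wilsonAction4_expChart_pureGauge_eq_norm_sq sum_plaq_boundary_sq_le
    norm_coe_specialUnitaryAd abs_deriv_deriv_wilsonAction4_expChart_sub_flat_le_local deriv_deriv_wilsonAction4_expChart_one_eq_norm_sq)

variable {P : Params} {j : ℕ} {N : ℕ} [NeZero N]

/-! ## §1 Letters -/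

omit [NeZero N] in
/-- `Ad_g (Ad_{g⁻¹} Y) = Y` — the rotation into the axial picture and back. [cite: Balaban1985Averaging, (57) p.27] -/
theorem specialUnitaryAd_apply_inv (g : Matrix.specialUnitaryGroup (Fin N) ℂ) (Y : lieSU (Fin N)) :
    specialUnitaryAd g (specialUnitaryAd g⁻¹ Y) = Y := by
  simpa only [inv_inv] using specialUnitaryAd_inv_apply g⁻¹ Y

/-- Every `SU(N)` element is within `2` of `1` in the operator norm (the trivial budget off the box). [folklore] -/
theorem norm_coe_sub_one_le_two (g : Matrix.specialUnitaryGroup (Fin N) ℂ) : ‖(g : Matrix (Fin N) (Fin N) ℂ) - 1‖ ≤ 2 := by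
  have h1 : ‖(g : Matrix (Fin N) (Fin N) ℂ)‖ = 1 := CStarRing.norm_of_mem_unitary g.2.1
  calc ‖(g : Matrix (Fin N) (Fin N) ℂ) - 1‖ ≤ ‖(g : Matrix (Fin N) (Fin N) ℂ)‖ + ‖(1 : Matrix (Fin N) (Fin N) ℂ)‖ := norm_sub_le _ _
    _ = 2 := by rw [h1, norm_one]; norm_num

/-- In the axial gauge of the box every bond variable INSIDE the box is within `(d−1)·n·θ` of `1` in the operator norm, when the box plaquettes are `θ`-small.
(✓ `dist1_gaugeAct_axialGauge_le_of_mem_boxBonds` read through `dist₁ = ‖· − 1‖`.) [cite: Balaban1984PropagatorsI, (1.10)–(1.11) p.19] [cite: Balaban1985Averaging, (19) p.21] -/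
theorem norm_gaugeAct_axialGauge_sub_one_le (U : GaugeField P j (Matrix.specialUnitaryGroup (Fin N) ℂ)) {lo hi : Fin P.d → ℤ} {θ : ℝ} {n : ℕ}
    (hU : PlaqSmallOn (boxPlaqs lo hi) θ U) (hθ : 0 ≤ θ) (hn : ∀ κ, hi κ ≤ lo κ + n) (hnN : n < P.sitesPerDir j)
    {b : PBond P j} (hb : b ∈ boxBonds lo hi) :
    ‖((GaugeField.gaugeAct (axialGauge U lo hi) U b : Matrix.specialUnitaryGroup (Fin N) ℂ) : Matrix (Fin N) (Fin N) ℂ) - 1‖ ≤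
      ((P.d - 1 : ℕ) : ℝ) * n * θ := by
  rw [← FederbushMean.dist1_SU_eq]
  exact dist1_gaugeAct_axialGauge_le_of_mem_boxBonds U subset_rfl hU hθ hn hnN hb

/-! ## §2 The on-event Hessian in the axial picture -/

/-- ★★★ **THE ON-EVENT HESSIAN IS THE FLAT FORM OF THE AXIAL-PICTURE TEST FIELD, UP TO `4(d−1)nθ·Σ_p s_p²`.**  Let the plaquettes of the non-wrapping box `[lo, hi]` (side `≤ n <
sitesPerDir j`) of `U` be `θ`-small, `u_U = axialGauge U lo hi`, and let `Y : bonds → 𝔰𝔲(N)` vanish on `∂p` for every plaquette `p` that has a bond outside `boxBonds lo hi`.  For the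
`U`-dependent direction `X_b = Ad_{u_U(b₊)⁻¹} Y_b`:
`|d²∕ds² A_W(U·e^{sX})∣₀ − (1∕N)·Σ_p ‖Y⟨x,μ⟩ + Y⟨x+e_μ,ν⟩ − Y⟨x+e_ν,μ⟩ − Y⟨x,ν⟩‖²| ≤ 4·(d−1)·n·θ · Σ_p (Σ_{k≤4} ‖Y_{b_k(p)}‖)²`.
(✓ `abs_deriv_deriv_wilsonAction4_expChart_sub_pureGauge_le` at `u = u_U`, budget `(d−1)nθ` inside ∕ `2` outside where `Y = 0`; ✓ `deriv_deriv_wilsonAction4_expChart_pureGauge_eq_norm_sq`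
and `Ad_u Ad_{u⁻¹} = id`.) [cite: Balaban1985BackgroundPropagators, (3.10) p.392] [cite: Balaban1989LargeFieldII, p.357–358] -/
theorem abs_hessian_axialRotated_sub_flat_le (U : GaugeField P j (Matrix.specialUnitaryGroup (Fin N) ℂ)) {lo hi : Fin P.d → ℤ} {θ : ℝ} {n : ℕ}
    (hU : PlaqSmallOn (boxPlaqs lo hi) θ U) (hθ : 0 ≤ θ) (hn : ∀ κ, hi κ ≤ lo κ + n) (hnN : n < P.sitesPerDir j)
    (Y : PBond P j → lieSU (Fin N))
    (hY : ∀ p : Plaq P j, ¬ ((⟨p.src, p.μ⟩ : PBond P j) ∈ boxBonds lo hi ∧ (⟨p.src.shift p.μ, p.ν⟩ : PBond P j) ∈ boxBonds lo hi ∧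
        (⟨p.src.shift p.ν, p.μ⟩ : PBond P j) ∈ boxBonds lo hi ∧ (⟨p.src, p.ν⟩ : PBond P j) ∈ boxBonds lo hi) →
      Y ⟨p.src, p.μ⟩ = 0 ∧ Y ⟨p.src.shift p.μ, p.ν⟩ = 0 ∧ Y ⟨p.src.shift p.ν, p.μ⟩ = 0 ∧ Y ⟨p.src, p.ν⟩ = 0) :
    |deriv (deriv fun s : ℝ => wilsonAction4 (expChart U (s • fun b => specialUnitaryAd (axialGauge U lo hi b.tgt)⁻¹ (Y b)))) 0
        - (∑ p : Plaq P j, ‖Y ⟨p.src, p.μ⟩ + Y ⟨p.src.shift p.μ, p.ν⟩ - Y ⟨p.src.shift p.ν, p.μ⟩ - Y ⟨p.src, p.ν⟩‖ ^ 2) / (Fintype.card (Fin N) : ℝ)|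
      ≤ 4 * (((P.d - 1 : ℕ) : ℝ) * n * θ) * ∑ p : Plaq P j, (‖(Y ⟨p.src, p.μ⟩ : Matrix (Fin N) (Fin N) ℂ)‖ + ‖(Y ⟨p.src.shift p.μ, p.ν⟩ : Matrix (Fin N) (Fin N) ℂ)‖
        + ‖(Y ⟨p.src.shift p.ν, p.μ⟩ : Matrix (Fin N) (Fin N) ℂ)‖ + ‖(Y ⟨p.src, p.ν⟩ : Matrix (Fin N) (Fin N) ℂ)‖) ^ 2 := by
  classical
  set u := axialGauge U lo hi with hu
  set X : PBond P j → lieSU (Fin N) := fun b => specialUnitaryAd (u b.tgt)⁻¹ (Y b) with hX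
  set δ₀ : ℝ := ((P.d - 1 : ℕ) : ℝ) * n * θ with hδ₀
  have hδ₀0 : 0 ≤ δ₀ := by rw [hδ₀]; positivity
  -- per-plaquette budget: `δ₀` when the four bonds are in the box, `2` otherwise
  let inside : Plaq P j → Prop := fun p => (⟨p.src, p.μ⟩ : PBond P j) ∈ boxBonds lo hi ∧ (⟨p.src.shift p.μ, p.ν⟩ : PBond P j) ∈ boxBonds lo hi ∧
    (⟨p.src.shift p.ν, p.μ⟩ : PBond P j) ∈ boxBonds lo hi ∧ (⟨p.src, p.ν⟩ : PBond P j) ∈ boxBonds lo hi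
  set δ : Plaq P j → ℝ := fun p => if inside p then δ₀ else 2 with hδ
  have hbudget : ∀ p : Plaq P j,
      ‖((GaugeField.gaugeAct u U ⟨p.src, p.μ⟩ : Matrix.specialUnitaryGroup (Fin N) ℂ) : Matrix (Fin N) (Fin N) ℂ) - 1‖ ≤ δ p ∧
      ‖((GaugeField.gaugeAct u U ⟨p.src.shift p.μ, p.ν⟩ : Matrix.specialUnitaryGroup (Fin N) ℂ) : Matrix (Fin N) (Fin N) ℂ) - 1‖ ≤ δ p ∧
      ‖((GaugeField.gaugeAct u U ⟨p.src.shift p.ν, p.μ⟩ : Matrix.specialUnitaryGroup (Fin N) ℂ) : Matrix (Fin N) (Fin N) ℂ) - 1‖ ≤ δ p ∧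
      ‖((GaugeField.gaugeAct u U ⟨p.src, p.ν⟩ : Matrix.specialUnitaryGroup (Fin N) ℂ) : Matrix (Fin N) (Fin N) ℂ) - 1‖ ≤ δ p := by
    intro p
    by_cases hp : inside p
    · have hδp : δ p = δ₀ := by rw [hδ]; simp only [hp, ↓reduceIte]
      rw [hδp]
      exact ⟨norm_gaugeAct_axialGauge_sub_one_le U hU hθ hn hnN hp.1, norm_gaugeAct_axialGauge_sub_one_le U hU hθ hn hnN hp.2.1,
        norm_gaugeAct_axialGauge_sub_one_le U hU hθ hn hnN hp.2.2.1, norm_gaugeAct_axialGauge_sub_one_le U hU hθ hn hnN hp.2.2.2⟩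
    · have hδp : δ p = 2 := by rw [hδ]; simp only [hp, ↓reduceIte]
      rw [hδp]
      exact ⟨norm_coe_sub_one_le_two _, norm_coe_sub_one_le_two _, norm_coe_sub_one_le_two _, norm_coe_sub_one_le_two _⟩
  have hmain := abs_deriv_deriv_wilsonAction4_expChart_sub_pureGauge_le u U X δ hbudget
  -- the comparison value is the flat form of `Y`
  rw [deriv_deriv_wilsonAction4_expChart_pureGauge_eq_norm_sq u X] at hmain
  simp only [hX, specialUnitaryAd_apply_inv, norm_coe_specialUnitaryAd] at hmain
  refine hmain.trans ?_
  -- the budgeted sum: outside plaquettes carry `s_p(Y) = 0`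
  rw [Finset.mul_sum, Finset.mul_sum]
  refine Finset.sum_le_sum fun p _ => ?_
  by_cases hp : inside p
  · have hδp : δ p = δ₀ := by rw [hδ]; simp only [hp, ↓reduceIte]
    rw [hδp]
    exact le_of_eq (by ring)
  · have hz := hY p hp
    have hδp : δ p = 2 := by rw [hδ]; simp only [hp, ↓reduceIte]
    rw [hδp, hz.1, hz.2.1, hz.2.2.1, hz.2.2.2]
    simp

/-- ★★★ **(A), ONE-SIDED: THE ON-EVENT HESSIAN IS DOMINATED BY THE FLAT FORM PLUS `4(d−1)nθ·Σ_p s_p²`** — `d²∕ds² A_W(U·e^{sX})∣₀ ≤ (1∕N)·Σ_p‖(dY)_p‖² + 4(d−1)nθ·Σ_p s_p(Y)²` for the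
axial-picture direction `X = Ad_{u_U⁻¹}Y`, under the hypotheses of `abs_hessian_axialRotated_sub_flat_le`. [cite: Balaban1985BackgroundPropagators, (3.10) p.392] [cite: Balaban1989LargeFieldII, p.357–358] -/
theorem hessian_axialRotated_le_flat_add (U : GaugeField P j (Matrix.specialUnitaryGroup (Fin N) ℂ)) {lo hi : Fin P.d → ℤ} {θ : ℝ} {n : ℕ}
    (hU : PlaqSmallOn (boxPlaqs lo hi) θ U) (hθ : 0 ≤ θ) (hn : ∀ κ, hi κ ≤ lo κ + n) (hnN : n < P.sitesPerDir j)
    (Y : PBond P j → lieSU (Fin N))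
    (hY : ∀ p : Plaq P j, ¬ ((⟨p.src, p.μ⟩ : PBond P j) ∈ boxBonds lo hi ∧ (⟨p.src.shift p.μ, p.ν⟩ : PBond P j) ∈ boxBonds lo hi ∧
        (⟨p.src.shift p.ν, p.μ⟩ : PBond P j) ∈ boxBonds lo hi ∧ (⟨p.src, p.ν⟩ : PBond P j) ∈ boxBonds lo hi) →
      Y ⟨p.src, p.μ⟩ = 0 ∧ Y ⟨p.src.shift p.μ, p.ν⟩ = 0 ∧ Y ⟨p.src.shift p.ν, p.μ⟩ = 0 ∧ Y ⟨p.src, p.ν⟩ = 0) :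
    deriv (deriv fun s : ℝ => wilsonAction4 (expChart U (s • fun b => specialUnitaryAd (axialGauge U lo hi b.tgt)⁻¹ (Y b)))) 0
      ≤ (∑ p : Plaq P j, ‖Y ⟨p.src, p.μ⟩ + Y ⟨p.src.shift p.μ, p.ν⟩ - Y ⟨p.src.shift p.ν, p.μ⟩ - Y ⟨p.src, p.ν⟩‖ ^ 2) / (Fintype.card (Fin N) : ℝ)
        + 4 * (((P.d - 1 : ℕ) : ℝ) * n * θ) * ∑ p : Plaq P j, (‖(Y ⟨p.src, p.μ⟩ : Matrix (Fin N) (Fin N) ℂ)‖ + ‖(Y ⟨p.src.shift p.μ, p.ν⟩ : Matrix (Fin N) (Fin N) ℂ)‖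
          + ‖(Y ⟨p.src.shift p.ν, p.μ⟩ : Matrix (Fin N) (Fin N) ℂ)‖ + ‖(Y ⟨p.src, p.ν⟩ : Matrix (Fin N) (Fin N) ℂ)‖) ^ 2 := by
  have h := abs_hessian_axialRotated_sub_flat_le U hU hθ hn hnN Y hY
  rw [abs_le] at h
  linarith [h.2]

/-- ★★ **(A) IN THE `ℓ²(bonds)` CURRENCY**: `d²∕ds² A_W(U·e^{sX})∣₀ ≤ (1∕N)·Σ_p‖(dY)_p‖² + 32(d−1)²·n·θ·Σ_b‖Y_b‖²` («each bond lies on `2(d−1)` plaquettes»,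
✓ `Node00.sum_plaq_boundary_sq_le`).  With a Poincaré constant `Σ_b‖Y_b‖² ≤ C_P·Σ_p‖(dY)_p‖²` for the chosen `Y` this reads `≤ (1 + ε)·(flat form)` with `ε = 32(d−1)²·n·θ·C_P·N`.
[cite: Balaban1985BackgroundPropagators, (3.10) p.392] [cite: Balaban1989LargeFieldII, p.357–358] -/
theorem hessian_axialRotated_le_flat_add_l2 (U : GaugeField P j (Matrix.specialUnitaryGroup (Fin N) ℂ)) {lo hi : Fin P.d → ℤ} {θ : ℝ} {n : ℕ}
    (hU : PlaqSmallOn (boxPlaqs lo hi) θ U) (hθ : 0 ≤ θ) (hn : ∀ κ, hi κ ≤ lo κ + n) (hnN : n < P.sitesPerDir j)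
    (Y : PBond P j → lieSU (Fin N))
    (hY : ∀ p : Plaq P j, ¬ ((⟨p.src, p.μ⟩ : PBond P j) ∈ boxBonds lo hi ∧ (⟨p.src.shift p.μ, p.ν⟩ : PBond P j) ∈ boxBonds lo hi ∧
        (⟨p.src.shift p.ν, p.μ⟩ : PBond P j) ∈ boxBonds lo hi ∧ (⟨p.src, p.ν⟩ : PBond P j) ∈ boxBonds lo hi) →
      Y ⟨p.src, p.μ⟩ = 0 ∧ Y ⟨p.src.shift p.μ, p.ν⟩ = 0 ∧ Y ⟨p.src.shift p.ν, p.μ⟩ = 0 ∧ Y ⟨p.src, p.ν⟩ = 0) :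
    deriv (deriv fun s : ℝ => wilsonAction4 (expChart U (s • fun b => specialUnitaryAd (axialGauge U lo hi b.tgt)⁻¹ (Y b)))) 0
      ≤ (∑ p : Plaq P j, ‖Y ⟨p.src, p.μ⟩ + Y ⟨p.src.shift p.μ, p.ν⟩ - Y ⟨p.src.shift p.ν, p.μ⟩ - Y ⟨p.src, p.ν⟩‖ ^ 2) / (Fintype.card (Fin N) : ℝ)
        + 32 * (((P.d - 1 : ℕ) : ℝ) * ((P.d : ℝ) - 1)) * n * θ * ∑ b : PBond P j, ‖(Y b : Matrix (Fin N) (Fin N) ℂ)‖ ^ 2 := by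
  have h := hessian_axialRotated_le_flat_add U hU hθ hn hnN Y hY
  have hl2 := sum_plaq_boundary_sq_le (P := P) (j := j) (fun b => ‖(Y b : Matrix (Fin N) (Fin N) ℂ)‖)
  have hc : 0 ≤ 4 * (((P.d - 1 : ℕ) : ℝ) * n * θ) := by positivity
  have := mul_le_mul_of_nonneg_left hl2 hc
  linarith

/-! ## §3 The same on the axial-gauge REPRESENTATIVE `V = U^{u_U}` (annex 4 §0 construction C3 ∕ §6 `stub_hessOnEvent`: the observable lives on `V`, the direction `u⁰` is FIXED) -/

/-- ★★★ **`stub_hessOnEvent` SHAPE: ON THE AXIAL-GAUGE REPRESENTATIVE THE HESSIAN IS THE FLAT FORM UP TO `4(d−1)nθ·Σ_p s_p²`.**  With `V := U^{axialGauge U lo hi}` and a FIXED direction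
`Y : bonds → 𝔰𝔲(N)` vanishing on `∂p` for every plaquette with a bond outside the box: `|d²∕ds² A_W(V·e^{sY})∣₀ − (1∕N)·Σ_p‖(dY)_p‖²| ≤ 4(d−1)·n·θ·Σ_p s_p(Y)²` whenever the box plaquettes
of `U` are `θ`-small (✓ `abs_deriv_deriv_wilsonAction4_expChart_sub_flat_le_local` at `V` with the axial budget, ✓ `deriv_deriv_wilsonAction4_expChart_one_eq_norm_sq`).  No `U`-dependent test
field here: the `U`-dependence sits in `V(U)` (annex 4 §0 «tree-gauge dressing»). [cite: Balaban1989LargeFieldII, p.357–358] [cite: Balaban1984PropagatorsI, (1.10)–(1.11) p.19] -/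
theorem abs_hessian_axialGaugeRep_sub_flat_le (U : GaugeField P j (Matrix.specialUnitaryGroup (Fin N) ℂ)) {lo hi : Fin P.d → ℤ} {θ : ℝ} {n : ℕ}
    (hU : PlaqSmallOn (boxPlaqs lo hi) θ U) (hθ : 0 ≤ θ) (hn : ∀ κ, hi κ ≤ lo κ + n) (hnN : n < P.sitesPerDir j)
    (Y : PBond P j → lieSU (Fin N))
    (hY : ∀ p : Plaq P j, ¬ ((⟨p.src, p.μ⟩ : PBond P j) ∈ boxBonds lo hi ∧ (⟨p.src.shift p.μ, p.ν⟩ : PBond P j) ∈ boxBonds lo hi ∧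
        (⟨p.src.shift p.ν, p.μ⟩ : PBond P j) ∈ boxBonds lo hi ∧ (⟨p.src, p.ν⟩ : PBond P j) ∈ boxBonds lo hi) →
      Y ⟨p.src, p.μ⟩ = 0 ∧ Y ⟨p.src.shift p.μ, p.ν⟩ = 0 ∧ Y ⟨p.src.shift p.ν, p.μ⟩ = 0 ∧ Y ⟨p.src, p.ν⟩ = 0) :
    |deriv (deriv fun s : ℝ => wilsonAction4 (expChart (GaugeField.gaugeAct (axialGauge U lo hi) U) (s • Y))) 0
        - (∑ p : Plaq P j, ‖Y ⟨p.src, p.μ⟩ + Y ⟨p.src.shift p.μ, p.ν⟩ - Y ⟨p.src.shift p.ν, p.μ⟩ - Y ⟨p.src, p.ν⟩‖ ^ 2) / (Fintype.card (Fin N) : ℝ)|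
      ≤ 4 * (((P.d - 1 : ℕ) : ℝ) * n * θ) * ∑ p : Plaq P j, (‖(Y ⟨p.src, p.μ⟩ : Matrix (Fin N) (Fin N) ℂ)‖ + ‖(Y ⟨p.src.shift p.μ, p.ν⟩ : Matrix (Fin N) (Fin N) ℂ)‖
        + ‖(Y ⟨p.src.shift p.ν, p.μ⟩ : Matrix (Fin N) (Fin N) ℂ)‖ + ‖(Y ⟨p.src, p.ν⟩ : Matrix (Fin N) (Fin N) ℂ)‖) ^ 2 := by
  classical
  set V := GaugeField.gaugeAct (axialGauge U lo hi) U with hV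
  set δ₀ : ℝ := ((P.d - 1 : ℕ) : ℝ) * n * θ with hδ₀
  let inside : Plaq P j → Prop := fun p => (⟨p.src, p.μ⟩ : PBond P j) ∈ boxBonds lo hi ∧ (⟨p.src.shift p.μ, p.ν⟩ : PBond P j) ∈ boxBonds lo hi ∧
    (⟨p.src.shift p.ν, p.μ⟩ : PBond P j) ∈ boxBonds lo hi ∧ (⟨p.src, p.ν⟩ : PBond P j) ∈ boxBonds lo hi
  set δ : Plaq P j → ℝ := fun p => if inside p then δ₀ else 2 with hδ
  have hbudget : ∀ p : Plaq P j,
      ‖((V ⟨p.src, p.μ⟩ : Matrix.specialUnitaryGroup (Fin N) ℂ) : Matrix (Fin N) (Fin N) ℂ) - 1‖ ≤ δ p ∧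
      ‖((V ⟨p.src.shift p.μ, p.ν⟩ : Matrix.specialUnitaryGroup (Fin N) ℂ) : Matrix (Fin N) (Fin N) ℂ) - 1‖ ≤ δ p ∧
      ‖((V ⟨p.src.shift p.ν, p.μ⟩ : Matrix.specialUnitaryGroup (Fin N) ℂ) : Matrix (Fin N) (Fin N) ℂ) - 1‖ ≤ δ p ∧
      ‖((V ⟨p.src, p.ν⟩ : Matrix.specialUnitaryGroup (Fin N) ℂ) : Matrix (Fin N) (Fin N) ℂ) - 1‖ ≤ δ p := by
    intro p
    by_cases hp : inside p
    · have hδp : δ p = δ₀ := by rw [hδ]; simp only [hp, ↓reduceIte]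
      rw [hδp, hV]
      exact ⟨norm_gaugeAct_axialGauge_sub_one_le U hU hθ hn hnN hp.1, norm_gaugeAct_axialGauge_sub_one_le U hU hθ hn hnN hp.2.1,
        norm_gaugeAct_axialGauge_sub_one_le U hU hθ hn hnN hp.2.2.1, norm_gaugeAct_axialGauge_sub_one_le U hU hθ hn hnN hp.2.2.2⟩
    · have hδp : δ p = 2 := by rw [hδ]; simp only [hp, ↓reduceIte]
      rw [hδp]
      exact ⟨norm_coe_sub_one_le_two _, norm_coe_sub_one_le_two _, norm_coe_sub_one_le_two _, norm_coe_sub_one_le_two _⟩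
  have hmain := abs_deriv_deriv_wilsonAction4_expChart_sub_flat_le_local V Y δ hbudget
  rw [deriv_deriv_wilsonAction4_expChart_one_eq_norm_sq] at hmain
  refine hmain.trans ?_
  rw [Finset.mul_sum, Finset.mul_sum]
  refine Finset.sum_le_sum fun p _ => ?_
  by_cases hp : inside p
  · have hδp : δ p = δ₀ := by rw [hδ]; simp only [hp, ↓reduceIte]
    rw [hδp]
    exact le_of_eq (by ring)
  · have hz := hY p hp
    have hδp : δ p = 2 := by rw [hδ]; simp only [hp, ↓reduceIte]
    rw [hδp, hz.1, hz.2.1, hz.2.2.1, hz.2.2.2]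
    simp

/-- ★★★ **`stub_hessOnEvent`, ONE-SIDED, `ℓ²(bonds)` CURRENCY**: `d²∕ds² A_W(V·e^{sY})∣₀ ≤ (1∕N)·Σ_p‖(dY)_p‖² + 32(d−1)²·n·θ·Σ_b‖Y_b‖²` on the axial-gauge representative `V = U^{u_U}`;
with the Poincaré constant of the chosen `Y` (✓ (D3♭)) this is the ideator's (A) «`K_G ≤ (1+ε)·‖dY‖²`», `ε = 32(d−1)²·n·θ·C_P·N`. [cite: Balaban1989LargeFieldII, p.357–358] [cite: Balaban1985BackgroundPropagators, (3.10) p.392] -/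
theorem hessian_axialGaugeRep_le_flat_add_l2 (U : GaugeField P j (Matrix.specialUnitaryGroup (Fin N) ℂ)) {lo hi : Fin P.d → ℤ} {θ : ℝ} {n : ℕ}
    (hU : PlaqSmallOn (boxPlaqs lo hi) θ U) (hθ : 0 ≤ θ) (hn : ∀ κ, hi κ ≤ lo κ + n) (hnN : n < P.sitesPerDir j)
    (Y : PBond P j → lieSU (Fin N))
    (hY : ∀ p : Plaq P j, ¬ ((⟨p.src, p.μ⟩ : PBond P j) ∈ boxBonds lo hi ∧ (⟨p.src.shift p.μ, p.ν⟩ : PBond P j) ∈ boxBonds lo hi ∧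
        (⟨p.src.shift p.ν, p.μ⟩ : PBond P j) ∈ boxBonds lo hi ∧ (⟨p.src, p.ν⟩ : PBond P j) ∈ boxBonds lo hi) →
      Y ⟨p.src, p.μ⟩ = 0 ∧ Y ⟨p.src.shift p.μ, p.ν⟩ = 0 ∧ Y ⟨p.src.shift p.ν, p.μ⟩ = 0 ∧ Y ⟨p.src, p.ν⟩ = 0) :
    deriv (deriv fun s : ℝ => wilsonAction4 (expChart (GaugeField.gaugeAct (axialGauge U lo hi) U) (s • Y))) 0
      ≤ (∑ p : Plaq P j, ‖Y ⟨p.src, p.μ⟩ + Y ⟨p.src.shift p.μ, p.ν⟩ - Y ⟨p.src.shift p.ν, p.μ⟩ - Y ⟨p.src, p.ν⟩‖ ^ 2) / (Fintype.card (Fin N) : ℝ)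
        + 32 * (((P.d - 1 : ℕ) : ℝ) * ((P.d : ℝ) - 1)) * n * θ * ∑ b : PBond P j, ‖(Y b : Matrix (Fin N) (Fin N) ℂ)‖ ^ 2 := by
  have h := abs_hessian_axialGaugeRep_sub_flat_le U hU hθ hn hnN Y hY
  rw [abs_le] at h
  have hl2 := sum_plaq_boundary_sq_le (P := P) (j := j) (fun b => ‖(Y b : Matrix (Fin N) (Fin N) ℂ)‖)
  have hc : 0 ≤ 4 * (((P.d - 1 : ℕ) : ℝ) * n * θ) := by positivity
  have := mul_le_mul_of_nonneg_left hl2 hc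
  linarith [h.2]

/-! ## §4 Discharging the support hypothesis: a direction supported one layer inside the box -/

section Support

omit [NeZero N]

/-- Unit lattice vectors are componentwise in `[0, 1]`. [folklore] -/
theorem e_apply_le_one (μ κ : Fin P.d) : e μ κ ≤ 1 := by rw [e_apply]; split_ifs <;> omega

/-- Unit lattice vectors are componentwise in `[0, 1]`. [folklore] -/
theorem e_apply_nonneg (μ κ : Fin P.d) : 0 ≤ e μ κ := by rw [e_apply]; split_ifs <;> omega

/-- The unit shift of torus sites is injective. [folklore] -/
theorem shift_injective {x y : Site P j} {μ : Fin P.d} (h : x.shift μ = y.shift μ) : x = y := by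
  have := congrArg (fun z => Site.unshift z μ) h
  simpa [Site.unshift_shift] using this

/-- If one of the four bonds of a plaquette lies in the INNER box `[lo + 1, hi − 1]`, the plaquette lies in the box `[lo, hi]`. [folklore] -/
theorem mem_boxPlaqs_of_bond_mem_inner {lo hi : Fin P.d → ℤ} {p : Plaq P j}
    (h : (⟨p.src, p.μ⟩ : PBond P j) ∈ boxBonds (lo + 1) (hi - 1) ∨ (⟨p.src.shift p.μ, p.ν⟩ : PBond P j) ∈ boxBonds (lo + 1) (hi - 1) ∨
      (⟨p.src.shift p.ν, p.μ⟩ : PBond P j) ∈ boxBonds (lo + 1) (hi - 1) ∨ (⟨p.src, p.ν⟩ : PBond P j) ∈ boxBonds (lo + 1) (hi - 1)) :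
    p ∈ boxPlaqs lo hi := by
  have hμ1 := e_apply_le_one (P := P) p.μ
  have hν1 := e_apply_le_one (P := P) p.ν
  have hμ0 := e_apply_nonneg (P := P) p.μ
  have hν0 := e_apply_nonneg (P := P) p.ν
  rcases h with ⟨z, hlo, hhi, hsrc⟩ | ⟨z, hlo, hhi, hsrc⟩ | ⟨z, hlo, hhi, hsrc⟩ | ⟨z, hlo, hhi, hsrc⟩ <;>
    rw [Pi.le_def] at hlo hhi <;> simp only [Pi.add_apply, Pi.sub_apply, Pi.one_apply] at hlo hhi hsrc
  · refine ⟨z, Pi.le_def.2 fun κ => ?_, Pi.le_def.2 fun κ => ?_, hsrc⟩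
    · linarith [hlo κ]
    · simp only [Pi.add_apply]; linarith [hhi κ, hν1 κ]
  · -- `p.src + e_μ = castSite z`, so `p.src = castSite (z − e_μ)`
    have hs : p.src = castSite (z - e p.μ) := by
      apply shift_injective (μ := p.μ)
      rw [← castSite_add_e, sub_add_cancel]; exact hsrc
    refine ⟨z - e p.μ, Pi.le_def.2 fun κ => ?_, Pi.le_def.2 fun κ => ?_, hs⟩
    · simp only [Pi.sub_apply]; linarith [hlo κ, hμ1 κ]
    · simp only [Pi.add_apply, Pi.sub_apply]; linarith [hhi κ]
  · have hs : p.src = castSite (z - e p.ν) := by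
      apply shift_injective (μ := p.ν)
      rw [← castSite_add_e, sub_add_cancel]; exact hsrc
    refine ⟨z - e p.ν, Pi.le_def.2 fun κ => ?_, Pi.le_def.2 fun κ => ?_, hs⟩
    · simp only [Pi.sub_apply]; linarith [hlo κ, hν1 κ]
    · simp only [Pi.add_apply, Pi.sub_apply]; linarith [hhi κ]
  · refine ⟨z, Pi.le_def.2 fun κ => ?_, Pi.le_def.2 fun κ => ?_, hsrc⟩
    · linarith [hlo κ]
    · simp only [Pi.add_apply]; linarith [hhi κ, hμ1 κ]

/-- ★ **THE SUPPORT HYPOTHESIS FROM A ONE-LAYER MARGIN**: a direction `Y` vanishing off the inner box `boxBonds (lo + 1) (hi − 1)` vanishes on `∂p` for every plaquette that is not fully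
inside `boxBonds lo hi` (the hypothesis `hY` of §2–§3). [folklore] -/
theorem support_hyp_of_vanish_off_inner {lo hi : Fin P.d → ℤ} (Y : PBond P j → lieSU (Fin N))
    (hYsupp : ∀ b : PBond P j, b ∉ boxBonds (lo + 1) (hi - 1) → Y b = 0) (p : Plaq P j)
    (hp : ¬ ((⟨p.src, p.μ⟩ : PBond P j) ∈ boxBonds lo hi ∧ (⟨p.src.shift p.μ, p.ν⟩ : PBond P j) ∈ boxBonds lo hi ∧
        (⟨p.src.shift p.ν, p.μ⟩ : PBond P j) ∈ boxBonds lo hi ∧ (⟨p.src, p.ν⟩ : PBond P j) ∈ boxBonds lo hi)) :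
    Y ⟨p.src, p.μ⟩ = 0 ∧ Y ⟨p.src.shift p.μ, p.ν⟩ = 0 ∧ Y ⟨p.src.shift p.ν, p.μ⟩ = 0 ∧ Y ⟨p.src, p.ν⟩ = 0 := by
  -- a plaquette of the box has its four bonds in the box (the statement of ✓ `ShellMeasureWilsonGaugeInvariant.bonds_mem_boxBonds` of the BalabanUV support tree;
  -- re-derived locally rather than importing that module)
  have hbonds : p ∈ boxPlaqs lo hi → (⟨p.src, p.μ⟩ : PBond P j) ∈ boxBonds lo hi ∧ (⟨p.src.shift p.μ, p.ν⟩ : PBond P j) ∈ boxBonds lo hi ∧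
      (⟨p.src.shift p.ν, p.μ⟩ : PBond P j) ∈ boxBonds lo hi ∧ (⟨p.src, p.ν⟩ : PBond P j) ∈ boxBonds lo hi := by
    rintro ⟨z, hlo, hhi, hsrc⟩
    have hμ0 := e_apply_nonneg (P := P) p.μ
    have hν0 := e_apply_nonneg (P := P) p.ν
    rw [Pi.le_def] at hlo hhi
    refine ⟨⟨z, Pi.le_def.2 hlo, Pi.le_def.2 fun κ => ?_, hsrc⟩, ⟨z + e p.μ, Pi.le_def.2 fun κ => ?_, Pi.le_def.2 fun κ => ?_, ?_⟩,
      ⟨z + e p.ν, Pi.le_def.2 fun κ => ?_, Pi.le_def.2 fun κ => ?_, ?_⟩, ⟨z, Pi.le_def.2 hlo, Pi.le_def.2 fun κ => ?_, hsrc⟩⟩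
    · have := hhi κ; simp only [Pi.add_apply] at this ⊢; linarith [hν0 κ]
    · have := hlo κ; simp only [Pi.add_apply]; linarith [hμ0 κ]
    · have := hhi κ; simp only [Pi.add_apply] at this ⊢; linarith
    · rw [hsrc, castSite_add_e]
    · have := hlo κ; simp only [Pi.add_apply]; linarith [hν0 κ]
    · have := hhi κ; simp only [Pi.add_apply] at this ⊢; linarith
    · rw [hsrc, castSite_add_e]
    · have := hhi κ; simp only [Pi.add_apply] at this ⊢; linarith [hμ0 κ]
  have key : ∀ b : PBond P j, (b ∈ boxBonds (lo + 1) (hi - 1) → p ∈ boxPlaqs lo hi) → Y b = 0 := fun b hb => by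
    by_cases hmem : b ∈ boxBonds (lo + 1) (hi - 1)
    · exact absurd (hbonds (hb hmem)) hp
    · exact hYsupp b hmem
  exact ⟨key _ fun h => mem_boxPlaqs_of_bond_mem_inner (Or.inl h), key _ fun h => mem_boxPlaqs_of_bond_mem_inner (Or.inr (Or.inl h)),
    key _ fun h => mem_boxPlaqs_of_bond_mem_inner (Or.inr (Or.inr (Or.inl h))), key _ fun h => mem_boxPlaqs_of_bond_mem_inner (Or.inr (Or.inr (Or.inr h)))⟩

end Support

/-- ★★★ **`stub_hessOnEvent` WITH THE SUPPORT MARGIN DISCHARGED**: for `Y` vanishing off `boxBonds (lo + 1) (hi − 1)`,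
`d²∕ds² A_W(V·e^{sY})∣₀ ≤ (1∕N)·Σ_p‖(dY)_p‖² + 32(d−1)²·n·θ·Σ_b‖Y_b‖²` on the axial-gauge representative `V = U^{u_U}` of a `θ`-small box.
[cite: Balaban1989LargeFieldII, p.357–358] [cite: Balaban1985BackgroundPropagators, (3.10) p.392] -/
theorem hessian_axialGaugeRep_le_flat_add_l2_of_vanish_off_inner (U : GaugeField P j (Matrix.specialUnitaryGroup (Fin N) ℂ)) {lo hi : Fin P.d → ℤ} {θ : ℝ} {n : ℕ}
    (hU : PlaqSmallOn (boxPlaqs lo hi) θ U) (hθ : 0 ≤ θ) (hn : ∀ κ, hi κ ≤ lo κ + n) (hnN : n < P.sitesPerDir j)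
    (Y : PBond P j → lieSU (Fin N)) (hYsupp : ∀ b : PBond P j, b ∉ boxBonds (lo + 1) (hi - 1) → Y b = 0) :
    deriv (deriv fun s : ℝ => wilsonAction4 (expChart (GaugeField.gaugeAct (axialGauge U lo hi) U) (s • Y))) 0
      ≤ (∑ p : Plaq P j, ‖Y ⟨p.src, p.μ⟩ + Y ⟨p.src.shift p.μ, p.ν⟩ - Y ⟨p.src.shift p.ν, p.μ⟩ - Y ⟨p.src, p.ν⟩‖ ^ 2) / (Fintype.card (Fin N) : ℝ)
        + 32 * (((P.d - 1 : ℕ) : ℝ) * ((P.d : ℝ) - 1)) * n * θ * ∑ b : PBond P j, ‖(Y b : Matrix (Fin N) (Fin N) ℂ)‖ ^ 2 :=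
  hessian_axialGaugeRep_le_flat_add_l2 U hU hθ hn hnN Y (support_hyp_of_vanish_off_inner Y hYsupp)

/-! ## §5 The bondwise hypothesis shape of annex 4 §6 («`max_{b∈Λ} dist₁(V_b, 1) ≤ η`, not as prose about a gauge») -/

/-- ★★★ **`stub_hessOnEvent`, BONDWISE FORM**: for ANY configuration `V` whose bond variables in the box `boxBonds lo hi` are within `η` of `1` and any direction `Y` vanishing
off the inner box `boxBonds (lo+1) (hi−1)`: `|d²∕ds² A_W(V·e^{sY})∣₀ − (1∕N)·Σ_p‖(dY)_p‖²| ≤ 4η·Σ_p s_p(Y)²` (✓ `Node00.abs_deriv_deriv_wilsonAction4_expChart_sub_flat_le_local` with the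
budget `η` inside ∕ `2` outside, + §4's support margin).  §3 is the instance `V = U^{u_U}`, `η = (d−1)nθ`. [cite: Balaban1989LargeFieldII, (1.9) p.358] [cite: Balaban1985BackgroundPropagators, (3.10) p.392] -/
theorem abs_hessian_sub_flat_le_of_bondSmallOn_box (V : GaugeField P j (Matrix.specialUnitaryGroup (Fin N) ℂ)) {lo hi : Fin P.d → ℤ} {η : ℝ}
    (hV : ∀ b : PBond P j, b ∈ boxBonds lo hi → ‖((V b : Matrix.specialUnitaryGroup (Fin N) ℂ) : Matrix (Fin N) (Fin N) ℂ) - 1‖ ≤ η)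
    (Y : PBond P j → lieSU (Fin N)) (hYsupp : ∀ b : PBond P j, b ∉ boxBonds (lo + 1) (hi - 1) → Y b = 0) :
    |deriv (deriv fun s : ℝ => wilsonAction4 (expChart V (s • Y))) 0
        - (∑ p : Plaq P j, ‖Y ⟨p.src, p.μ⟩ + Y ⟨p.src.shift p.μ, p.ν⟩ - Y ⟨p.src.shift p.ν, p.μ⟩ - Y ⟨p.src, p.ν⟩‖ ^ 2) / (Fintype.card (Fin N) : ℝ)|
      ≤ 4 * η * ∑ p : Plaq P j, (‖(Y ⟨p.src, p.μ⟩ : Matrix (Fin N) (Fin N) ℂ)‖ + ‖(Y ⟨p.src.shift p.μ, p.ν⟩ : Matrix (Fin N) (Fin N) ℂ)‖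
        + ‖(Y ⟨p.src.shift p.ν, p.μ⟩ : Matrix (Fin N) (Fin N) ℂ)‖ + ‖(Y ⟨p.src, p.ν⟩ : Matrix (Fin N) (Fin N) ℂ)‖) ^ 2 := by
  classical
  let inside : Plaq P j → Prop := fun p => (⟨p.src, p.μ⟩ : PBond P j) ∈ boxBonds lo hi ∧ (⟨p.src.shift p.μ, p.ν⟩ : PBond P j) ∈ boxBonds lo hi ∧
    (⟨p.src.shift p.ν, p.μ⟩ : PBond P j) ∈ boxBonds lo hi ∧ (⟨p.src, p.ν⟩ : PBond P j) ∈ boxBonds lo hi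
  set δ : Plaq P j → ℝ := fun p => if inside p then η else 2 with hδ
  have hbudget : ∀ p : Plaq P j,
      ‖((V ⟨p.src, p.μ⟩ : Matrix.specialUnitaryGroup (Fin N) ℂ) : Matrix (Fin N) (Fin N) ℂ) - 1‖ ≤ δ p ∧
      ‖((V ⟨p.src.shift p.μ, p.ν⟩ : Matrix.specialUnitaryGroup (Fin N) ℂ) : Matrix (Fin N) (Fin N) ℂ) - 1‖ ≤ δ p ∧
      ‖((V ⟨p.src.shift p.ν, p.μ⟩ : Matrix.specialUnitaryGroup (Fin N) ℂ) : Matrix (Fin N) (Fin N) ℂ) - 1‖ ≤ δ p ∧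
      ‖((V ⟨p.src, p.ν⟩ : Matrix.specialUnitaryGroup (Fin N) ℂ) : Matrix (Fin N) (Fin N) ℂ) - 1‖ ≤ δ p := by
    intro p
    by_cases hp : inside p
    · have hδp : δ p = η := by rw [hδ]; simp only [hp, ↓reduceIte]
      rw [hδp]
      exact ⟨hV _ hp.1, hV _ hp.2.1, hV _ hp.2.2.1, hV _ hp.2.2.2⟩
    · have hδp : δ p = 2 := by rw [hδ]; simp only [hp, ↓reduceIte]
      rw [hδp]
      exact ⟨norm_coe_sub_one_le_two _, norm_coe_sub_one_le_two _, norm_coe_sub_one_le_two _, norm_coe_sub_one_le_two _⟩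
  have hmain := abs_deriv_deriv_wilsonAction4_expChart_sub_flat_le_local V Y δ hbudget
  rw [deriv_deriv_wilsonAction4_expChart_one_eq_norm_sq] at hmain
  refine hmain.trans ?_
  rw [Finset.mul_sum, Finset.mul_sum]
  refine Finset.sum_le_sum fun p _ => ?_
  by_cases hp : inside p
  · have hδp : δ p = η := by rw [hδ]; simp only [hp, ↓reduceIte]
    rw [hδp]
    exact le_of_eq (by ring)
  · have hz := support_hyp_of_vanish_off_inner Y hYsupp p hp
    have hδp : δ p = 2 := by rw [hδ]; simp only [hp, ↓reduceIte]
    rw [hδp, hz.1, hz.2.1, hz.2.2.1, hz.2.2.2]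
    simp

/-- ★★★ **`stub_hessOnEvent`, BONDWISE, ONE-SIDED, `ℓ²(bonds)`**: `d²∕ds² A_W(V·e^{sY})∣₀ ≤ (1∕N)·Σ_p‖(dY)_p‖² + 32(d−1)·η·Σ_b‖Y_b‖²` for `V` bondwise `η`-near `1` on the box and `Y`
vanishing off the inner box — annex 4 §6's displayed shape up to the consumer's Poincaré constant. [cite: Balaban1989LargeFieldII, (1.9) p.358] [cite: Balaban1985BackgroundPropagators, (3.10) p.392] -/
theorem hessian_le_flat_add_l2_of_bondSmallOn_box (V : GaugeField P j (Matrix.specialUnitaryGroup (Fin N) ℂ)) {lo hi : Fin P.d → ℤ} {η : ℝ} (hη : 0 ≤ η)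
    (hV : ∀ b : PBond P j, b ∈ boxBonds lo hi → ‖((V b : Matrix.specialUnitaryGroup (Fin N) ℂ) : Matrix (Fin N) (Fin N) ℂ) - 1‖ ≤ η)
    (Y : PBond P j → lieSU (Fin N)) (hYsupp : ∀ b : PBond P j, b ∉ boxBonds (lo + 1) (hi - 1) → Y b = 0) :
    deriv (deriv fun s : ℝ => wilsonAction4 (expChart V (s • Y))) 0
      ≤ (∑ p : Plaq P j, ‖Y ⟨p.src, p.μ⟩ + Y ⟨p.src.shift p.μ, p.ν⟩ - Y ⟨p.src.shift p.ν, p.μ⟩ - Y ⟨p.src, p.ν⟩‖ ^ 2) / (Fintype.card (Fin N) : ℝ)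
        + 32 * ((P.d : ℝ) - 1) * η * ∑ b : PBond P j, ‖(Y b : Matrix (Fin N) (Fin N) ℂ)‖ ^ 2 := by
  have h := abs_hessian_sub_flat_le_of_bondSmallOn_box V hV Y hYsupp
  rw [abs_le] at h
  have hl2 := sum_plaq_boundary_sq_le (P := P) (j := j) (fun b => ‖(Y b : Matrix (Fin N) (Fin N) ℂ)‖)
  have hc : 0 ≤ 4 * η := by positivity
  have := mul_le_mul_of_nonneg_left hl2 hc
  linarith [h.2]

end Summit.QuantumFields.YangMills.Theorems.UnitScaleGibbsOnEventHessianAxialGauge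

end
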